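import Summits.ResolutionOfSingularities.ResolutionOfSingularities.Theorems.PurelyInseparableDim4AtlasSurvivalChart
import Summits.ResolutionOfSingularities.ResolutionOfSingularities.Theorems.PurelyInseparableDim4AtlasMemberDefsThree
import Summits.ResolutionOfSingularities.ResolutionOfSingularities.Theorems.PurelyInseparableDim4JointTree
import HarnessLib

/-!
# Purely inseparable four-folds: an ATLAS MEMBER SURVIVES the blow-up of a disjoint centre (brick S3 (c) v4, tranche 1, brick A2;
# cell `res-dim4-pi`)

[OURS · counted 0] (D-0157 DOOR 2; host item stmt-ResolutionOfSingularities-16155, helper). Nothing here proves resolution of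
singularities in dimension ≥ 4 / characteristic `p`. A2 of `res-dim4-typ-3/S3c-V4-ATLAS-MEMBERS-DESIGN.md` §2: if `π : W → X′` blows up a
centre `Ce` disjoint from an atlas member `c` carrying `MemberDataAT` (DefsThree), then `π⁻¹c` carries `MemberDataAT` for the transformed
marked ideal with the SAME readings: basics, format invariant, blocks and accessibility are model data and unchanged; regularity and snc
by v3's `member_survival_global` (the member lies in the support by the atlas cover and per-reading permissibility); every reading's zigzag
survives by `reading_survival_zigzag_shape` (A2-chart), owned parts and fibre pieces are pulled back (`φ′(ψ′⁻¹ D) = π⁻¹ φ(ψ⁻¹ D)`), so the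
cover, the disjointness and the fibre-closedness survive.

* `image_preimage_subset_member`, `coe_member_subset_support_of_atlasZF`, **`memberDataAT_survival`**.

AI-produced formalisation, weaker than expert review. bears_on: LADDER-RESOLUTION:D157-DOOR2 (res-dim4-pi · S3 (c) v4 A2).
-/

set_option linter.dupNamespace false -- D-0017: single-problem summit path `Summit.<S>.<S>.…` by design

noncomputable section

open MvPolynomial Finset CategoryTheory AlgebraicGeometry Opposite TopologicalSpace
open AlgebraicGeometry.Scheme.IdealSheafData (ofIdealTop vanishingIdeal)

namespace Summit.ResolutionOfSingularities.ResolutionOfSingularities.Theorems.PIDim4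

open Literature.AlgebraicGeometry.Resolution
open Literature.AlgebraicGeometry.Resolution.Hauser2010
open Literature.AlgebraicGeometry.Resolution.AffinePointBlowup (P A γ coord Wtop ξ)

namespace Equimultiple

section SurvivalAT

variable {K : Type} [Field K] {p : ℕ} [hp : Fact p.Prime] [CharP K p] [DecidableEq K]
variable {X' W Y : Scheme.{0}} {π : W ⟶ X'} {Ce : X'.IdealSheafData}

omit hp [CharP K p] [DecidableEq K] in
/-- On a reading's zigzag, the image of any part of `V(z, x_T)` lies in the member. [folklore] -/
theorem image_preimage_subset_member (φ : Y ⟶ X') (ψ : Y ⟶ P 4 K) (c : Closeds X') {T : Finset (Fin 4)}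
    (hZ : (vanishingIdeal c).comap φ = (AffineCoordBlowup.𝓘Λ 4 K (insert 0 (Fin.succ '' (T : Set (Fin 4))))).comap ψ)
    {D : Set (P 4 K)} (hD : D ⊆ (AffineCoordBlowup.CΛ 4 K (insert 0 (Fin.succ '' (T : Set (Fin 4)))) : Set (P 4 K))) :
    φ '' (ψ ⁻¹' D) ⊆ (c : Set X') := by
  rintro _ ⟨y, hy, rfl⟩
  exact (mem_member_iff_mem_CΛ φ ψ c hZ y).mpr (hD hy)

omit hp [CharP K p] in
/-- **An atlas member lies in the support of the marked ideal** (BGMW Def. 3.1.3 (1)): by the cover of `MemberAtlasZF` and the order of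
`z^p + F_r` along `V(z, x_{T_r})` on every reading. [cite: BierstoneGrigorievMilmanWlodarczyk2011, Def. 3.1.3 (1)] -/
theorem coe_member_subset_support_of_atlasZF [IsLocallyNoetherian X'] (M' : MarkedIdeal X') (hmult : M'.mult = p) (c : Closeds X')
    (R : Finset (AReading K)) (hatlas : MemberAtlasZF p M' c R) (hperm : ∀ r ∈ R, (p : ℕ∞) ≤ CentreBlowup.ordAlong r.2.1 r.1.F) :
    (c : Set X') ⊆ M'.support := by
  obtain ⟨Yc, φ, ψ, hcl, hcov, -⟩ := hatlas
  intro x hx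
  obtain ⟨r, y, hy, rfl⟩ := Set.mem_iUnion.mp (hcov hx)
  obtain ⟨_, _, hM, -, -⟩ := hcl r
  have hy' : ψ r y ∈ AffineCoordBlowup.CΛ 4 K (insert 0 (Fin.succ '' (r.1.2.1 : Set (Fin 4)))) := by
    have h := hy
    simp only [Set.mem_preimage, ownedSetZ, Set.mem_setOf_eq] at h
    exact h.1
  change (M'.mult : ℕ∞) ≤ idealOrder M'.ideal (φ r y)
  rw [hmult, ← idealOrder_comap_of_isOpenImmersion (φ r) M'.ideal y, hM, idealOrder_comap_of_isOpenImmersion (ψ r) _ y]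
  exact ChartDictionary.le_idealOrder_hypSheaf_of_mem_CΛ p _ _ (hperm r.1 r.2) hy'

/-- **AN ATLAS MEMBER SURVIVES THE BLOW-UP OF A DISJOINT CENTRE (A2).** See the module docstring.
[cite: BierstoneGrigorievMilmanWlodarczyk2011, Def. 3.1.3 (2), (4)] [cite: StacksProject, Tag 02OS] -/
theorem memberDataAT_survival [IsAlgClosed K] [IsLocallyNoetherian X'] [IsLocallyNoetherian W] (hπ : IsBlowup π Ce)
    (M' : MarkedIdeal X') (hmult : M'.mult = p) (hsncC : HasSNCWith M'.boundary Ce)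
    (plan : AReading K → Finset (Fin 4 × (Fin 4 → K) × Finset (Fin 4)))
    (leaves : AReading K → Finset (Fin 4 × (Fin 4 → K)))
    (c : Closeds X') (hdisj : Disjoint (c : Set X') (Ce.support : Set X')) {R : Finset (AReading K)}
    (h : MemberDataAT p plan leaves M' c R) :
    MemberDataAT p plan leaves (M'.transform π Ce) (c.preimage π.continuous) R := by
  classical
  obtain ⟨hbasic, hfmt, hreg, hsnc, hatlas, hblocks, hacc⟩ := h
  have hsub : (c : Set X') ⊆ M'.support :=
    coe_member_subset_support_of_atlasZF M' hmult c R hatlas fun r hr => (hbasic r hr).2.2.2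
  obtain ⟨Yc, φ, ψ, hcl, hcov, hdis⟩ := hatlas
  -- global survival
  obtain ⟨hreg', -, hsnc'⟩ := member_survival_global hπ M' c hdisj hreg hsub hsncC hsnc
  -- every reading survives
  have key : ∀ r : ↥R, ∃ (Y' : Scheme.{0}) (φ' : Y' ⟶ W) (ψ' : Y' ⟶ P 4 K) (_ : IsOpenImmersion φ') (_ : IsOpenImmersion ψ'),
      (controlledTransform π Ce M'.ideal M'.mult).comap φ' = (hypSheaf p r.1.1.F).comap ψ' ∧
      (vanishingIdeal (c.preimage π.continuous)).comap φ' =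
        (AffineCoordBlowup.𝓘Λ 4 K (insert 0 (Fin.succ '' (r.1.2.1 : Set (Fin 4))))).comap ψ' ∧
      (AffineCoordBlowup.CΛ 4 K (insert 0 (Fin.succ '' (r.1.2.1 : Set (Fin 4)))) : Set (P 4 K)) ⊆ Set.range ψ' ∧
      (∀ D : Set (P 4 K), D ⊆ Set.range (ψ r) → Disjoint (φ r '' (ψ r ⁻¹' D)) (Ce.support : Set X') →
        D ⊆ Set.range ψ' ∧ φ' '' (ψ' ⁻¹' D) = π ⁻¹' (φ r '' (ψ r ⁻¹' D))) ∧
      ∃ (idx₂ : W.IdealSheafData → Fin 4) (cst₂ : W.IdealSheafData → K),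
        (∀ D₂ ∈ M'.boundary.map (strictTransformIdeal π Ce) ++ [Ce.comap π],
          ((D₂.support : Set W) ∩ φ' '' (ψ' ⁻¹'
            (AffineCoordBlowup.CΛ 4 K (insert 0 (Fin.succ '' (r.1.2.1 : Set (Fin 4)))) : Set (P 4 K)))).Nonempty →
          D₂.comap φ' = (ofIdealTop (Ideal.span {(γ 4 K).symm (X (idx₂ D₂).succ + C (cst₂ D₂))})).comap ψ' ∧
            (idx₂ D₂ ∈ r.1.2.1 → cst₂ D₂ = 0)) ∧
        (∀ D₁ ∈ M'.boundary.map (strictTransformIdeal π Ce) ++ [Ce.comap π],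
          ∀ D₂ ∈ M'.boundary.map (strictTransformIdeal π Ce) ++ [Ce.comap π],
          ((D₁.support : Set W) ∩ φ' '' (ψ' ⁻¹'
            (AffineCoordBlowup.CΛ 4 K (insert 0 (Fin.succ '' (r.1.2.1 : Set (Fin 4)))) : Set (P 4 K)))).Nonempty →
          ((D₂.support : Set W) ∩ φ' '' (ψ' ⁻¹'
            (AffineCoordBlowup.CΛ 4 K (insert 0 (Fin.succ '' (r.1.2.1 : Set (Fin 4)))) : Set (P 4 K)))).Nonempty →
          idx₂ D₁ = idx₂ D₂ → D₁ = D₂) := by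
    intro r
    obtain ⟨hφ, hψ, hM, hZ, hsee, -, idx, cst_, hshape, hinj⟩ := hcl r
    exact reading_survival_zigzag_shape hπ c hdisj (φ r) (ψ r) M'.ideal (hypSheaf p r.1.1.F) hM M'.mult hZ hsee M'.boundary idx cst_
      hshape hinj
  choose Y' φ' ψ' hφ' hψ' hM' hZ' hsee' hvis hdict using key
  -- images of parts of `V(z, x_T)` miss the centre
  have hmiss : ∀ (r : ↥R) (D : Set (P 4 K)), D ⊆ (AffineCoordBlowup.CΛ 4 K (insert 0 (Fin.succ '' (r.1.2.1 : Set (Fin 4)))) : Set (P 4 K)) →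
      D ⊆ Set.range (ψ r) ∧ Disjoint (φ r '' (ψ r ⁻¹' D)) (Ce.support : Set X') := by
    intro r D hD
    obtain ⟨_, _, -, hZ, hsee, -⟩ := hcl r
    exact ⟨hD.trans hsee, Set.disjoint_of_subset_left (image_preimage_subset_member (φ r) (ψ r) c hZ hD) hdisj⟩
  have hownCΛ : ∀ (T : Finset (Fin 4)) (X : Finset (Fin 4 × K)),
      ownedSetZ T X ⊆ (AffineCoordBlowup.CΛ 4 K (insert 0 (Fin.succ '' (T : Set (Fin 4)))) : Set (P 4 K)) := by
    intro T X x hx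
    simp only [ownedSetZ, Set.mem_setOf_eq] at hx
    exact hx.1
  have hpull : ∀ (r : ↥R) (X : Finset (Fin 4 × K)),
      φ' r '' (ψ' r ⁻¹' ownedSetZ r.1.2.1 X) = π ⁻¹' (φ r '' (ψ r ⁻¹' ownedSetZ r.1.2.1 X)) := by
    intro r X
    obtain ⟨h1, h2⟩ := hmiss r _ (hownCΛ r.1.2.1 X)
    exact (hvis r _ h1 h2).2
  refine ⟨hbasic, hfmt, hreg', hsnc', ⟨Y', φ', ψ', fun r => ⟨hφ' r, hψ' r, ?_, hZ' r, hsee' r, fun v => ?_, hdict r⟩, ?_, ?_⟩,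
    hblocks, hacc⟩
  · rw [MarkedIdeal.transform_ideal]
    exact hM' r
  · -- fibre pieces stay closed
    obtain ⟨_, _, -, -, -, hfib, -⟩ := hcl r
    rw [hpull r]
    exact (hfib v).preimage π.continuous
  · -- the cover
    intro w hw
    have hwc : π w ∈ (c : Set X') := hw
    obtain ⟨r, hr⟩ := Set.mem_iUnion.mp (hcov hwc)
    refine Set.mem_iUnion.mpr ⟨r, ?_⟩
    rw [hpull r]
    exact hr
  · -- disjointness
    intro r r' hne
    rw [hpull r, hpull r']
    exact (hdis r r' hne).preimage π

end SurvivalAT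

end Equimultiple

end Summit.ResolutionOfSingularities.ResolutionOfSingularities.Theorems.PIDim4

end
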